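import Literature.NumberTheory.LFunctions.RHWave0
import Literature.NumberTheory.Congruences.LeastQuadraticNonresidue
import HarnessLib

/-!
# Conditional (GRH) bounds for the least prime outside a subgroup of `(ℤ/qℤ)ˣ`, the least quadratic
# non-residue, the least prime in a coset and the least prime in an arithmetic progression
# (Lamzouri–Li–Soundararajan, Math. Comp. 84 (2015), §§1.1–1.2: Theorems 1.1–1.4, Corollaries 1.1–1.2,
# with the 2017 Corrigendum for Theorems 1.2–1.3)

Topic `Literature/NumberTheory/LFunctions` (namespace `Literature.NumberTheory.LFunctions`). Statement
layer (one file for §§1.1–1.2 of the source, D-0064); companion of `ConditionalLOneBoundsGRH.lean`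
(§1.3 of the same paper). Typed by the cross-ladder literature-typing seat `littype-FP2-2` for the cells
`parity-realchar` (what GRH gives where the exceptional-character world gives Linnik-type statements:
`P(a, q) ≤ (φ(q) log q)²`, least prime outside a subgroup `≪ (log q)²`) and `landau-siegel`.

Source: Y. Lamzouri, X. Li, K. Soundararajan, *Conditional bounds for the least quadratic non-residue and
related problems*, Math. Comp. **84** (2015) 2391–2412 [LamzouriLiSoundararajan2015] (journal PDF read,
pp. 2391–2393), and the *Corrigendum*, Math. Comp. **86** (2017) 2551–2554
[LamzouriLiSoundararajan2017Corrigendum] (read in full): "an error in Lemma 6.1 of our paper, which affects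
the asymptotic bounds in Theorems 1.2 and 1.3 there. These results must be replaced with the following
corrected versions. All the other results in the paper, including all explicit bounds, remain
unaltered." Theorems 1.2 and 1.3 are typed in their CORRECTED 2017 form.

## What the source says (verbatim)

p. 2391: "Let `q > 1` be a natural number and let `G = (ℤ/qℤ)*` denote the group of reduced residues
(mod `q`). Given a proper subgroup `H` of `G` […] (1) Determine or estimate the least prime `p` not
dividing `q` and lying outside the subgroup `H`, and (2) Given a coset of `H` in `G`, determine or
estimate the least prime `p` lying in that coset." (p. 2392: "Bach showed, on GRH, that the least prime
`p` that does not lie in `H` is at most `2(log q)²`, and if the additional natural requirement that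
`p ∤ q` is imposed then `p` is less than `3(log q)²`" — so "not lying in `H`" INCLUDES the primes
dividing `q`.)

* **Theorem 1.1** (p. 2392). "Assume GRH. Let `q ≥ 3000` be an integer, and let `H` be a proper
  subgroup of `G = (ℤ/qℤ)*`. (1) Let `A(q) = max(0, 2 log log q − 8/5 − Σ_{p∣q} (log p)/(p−1))`, and put
  `B(q) = max(0, 2 log log q + 3 + 2ω(q)(log log q)²/log q − 2A(q))`. The least prime `ℓ` with `ℓ ∤ q`
  and `ℓ` not lying in the subgroup `H` satisfies the bound `ℓ ≤ (log q + B(q))²`. (2) Suppose `q` is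
  not divisible by any prime below `(log q)²`. Then there is a prime `ℓ ≤ (log q)²` with `ℓ` not lying
  in the subgroup `H`."
* **Corollary 1.1** (p. 2392). "Assume GRH. If `q ≥ 5` is prime, the least quadratic non-residue (mod `q`)
  lies below `(log q)²`."
* **Theorem 1.2** (CORRECTED, Corrigendum p. 2551). "Assume GRH. Let `q` be a large integer and let `H`
  be a subgroup of `G = (ℤ/qℤ)*` with index `h = [G : H] > 1`. Then the least prime `p` not in `H`
  satisfies `p < (α(h) + o(1))(log q)²`, where `α(2) = 0.8`, `α(3) = 0.7` and in general `α(h) = 0.66`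
  for all `h > 3`." (2015 printed: `0.42, 0.49, 0.51` — superseded.)
* **Theorem 1.3** (CORRECTED, Corrigendum p. 2551). "Assume GRH. Let `q` be a large integer and let `H`
  be a subgroup of `G = (ℤ/qℤ)*` with index `h = [G : H] ≥ 4`. Then the least prime `p` not in `H`
  satisfies `p < (1/4 + o(1)) (1 − 1/h)² (log(2h)/(log(2h) − 4))² (log q)²`." (2015 printed:
  `log(2h) − 2` — superseded.)
* **Theorem 1.4** (p. 2393). "Assume GRH. Let `q ≥ 20000` and let `H` be a subgroup of `G = (ℤ/qℤ)*` with
  index `h = [G : H] > 1`. Let `p` be the smallest prime lying in a given coset `aH`. Then either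
  `p ≤ 10⁹`, or `p ≤ ((h − 1) log q + 3(h + 1) + (5/2)(log log q)²)²`."
* **Corollary 1.2** (p. 2393). "Assume GRH. Let `q > 3`, and let `a` (mod `q`) be a reduced residue
  class. The least prime in the arithmetic progression `a` (mod `q`) satisfies `P(a, q) ≤ (φ(q) log q)²`."
* GRH: as in `ConditionalLOneBoundsGRH.lean` — the tree's `GeneralizedRiemannHypothesis` (`RHWave0.lean`).

## How it is typed

* `G = (ℤ/qℤ)*` is Mathlib's `(ZMod q)ˣ`; a subgroup `H : Subgroup (ZMod q)ˣ`; "proper" is `H ≠ ⊤`,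
  "index `h > 1`" is `1 < H.index`. "`n` lies in `H`" (`LamzouriLiSoundararajan2015.LiesIn H n`):
  the residue `n mod q` is the image of an element of `H` — so a prime dividing `q` lies in NO subgroup
  (the convention of p. 2392, see above); "`n` lies in the coset `aH`" (`LiesInCoset H a n`):
  `n ≡ a u (mod q)` for some `u ∈ H`. `ω(q) = #q.primeFactors`; `φ = Nat.totient`;
  `A`, `B`, `α` as definitions with bodies.
* "The least such prime satisfies `≤ X`" is typed as "some such prime is `≤ X`" (equivalent).
  Corollary 1.1 uses the tree's `Literature.NumberTheory.Congruences.LeastNonresidue.leastNonresidue`;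
  "lies below `(log q)²`" is typed `≤` (the weaker reading; `(log q)²` is never an integer for an
  integer `q > 1`, so nothing is lost).
* Theorems 1.2/1.3 ("`q` large", "`o(1)`"): for every `ε > 0` and every admissible index `h` there is
  `q₀ = q₀(ε, h)` beyond which the bound holds with `o(1)` replaced by `ε` — the threshold is allowed
  to depend on `h` (the weaker reading of the printed uniformity).
* Theorem 1.4: "either `p ≤ 10⁹` or `p ≤ (…)²`" verbatim as a disjunction, for some prime in the coset.
* Six NAMED FACTS (D-0014: published, unproved here), one per printed statement; PROVED glue:
  `LiesIn.isUnit`, `not_liesIn_of_dvd` (primes dividing `q` lie in no subgroup), `liesInCoset_one_iff`,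
  and `leastPrimeAP_le_sq_of_corollary12` (`P(a, q) ≤ (q log q)²`, the shape of Bach–Sorenson (1.2)
  with constant `1`).

LABEL (cell rule): statement layer; GRH is a HYPOTHESIS inside each fact; no compute. WHAT THIS IS NOT:
nothing unconditional (the tree's unconditional statements are `linnik_leastPrimeAP`, the Linnik-constant
records, and `leastNonresidue_lt_one_add_sqrt`).

## References

* [LamzouriLiSoundararajan2015] Math. Comp. 84 (2015) 2391–2412 — Thm 1.1, Cor 1.1, Thms 1.2–1.3
  (p. 2392), Thm 1.4, Cor 1.2 (p. 2393).
* [LamzouriLiSoundararajan2017Corrigendum] Math. Comp. 86 (2017) 2551–2554 — corrected Theorems 1.2, 1.3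
  (p. 2551), §2 (corrections to Lemma 6.1 / Proposition 6.1; `0.794`, `0.7`, `0.66`, limit `0.545`).
* [NivenZuckerman1966] Thm 3.9 (the tree's `leastNonresidue`).
-/

noncomputable section

namespace Literature.NumberTheory.LFunctions

namespace LamzouriLiSoundararajan2015

/-- "`n` lies in the subgroup `H` of `G = (ℤ/qℤ)*`": the residue of `n` mod `q` is the image of an
element of `H`. A prime dividing `q` (a non-unit mod `q`) lies in no subgroup — the convention of the
source ("the least prime `p` that does not lie in `H` … if the additional natural requirement that
`p ∤ q` is imposed", p. 2392). [cite: LamzouriLiSoundararajan2015, §1 p. 2391–2392] -/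
def LiesIn {q : ℕ} (H : Subgroup (ZMod q)ˣ) (n : ℕ) : Prop :=
  ∃ u ∈ H, ((u : (ZMod q)ˣ) : ZMod q) = (n : ZMod q)

/-- "`n` lies in the coset `aH`": `n ≡ a·u (mod q)` for some `u ∈ H`.
[cite: LamzouriLiSoundararajan2015, §1 p. 2391 (question (2)) and Theorem 1.4 p. 2393] -/
def LiesInCoset {q : ℕ} (H : Subgroup (ZMod q)ˣ) (a : (ZMod q)ˣ) (n : ℕ) : Prop :=
  ∃ u ∈ H, (((a * u : (ZMod q)ˣ)) : ZMod q) = (n : ZMod q)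

/-- `A(q) = max(0, 2 log log q − 8/5 − Σ_{p∣q} (log p)/(p − 1))` (Theorem 1.1).
[cite: LamzouriLiSoundararajan2015, Theorem 1.1 p. 2392] -/
def A (q : ℕ) : ℝ :=
  max 0 (2 * Real.log (Real.log q) - 8 / 5 - ∑ p ∈ q.primeFactors, Real.log p / ((p : ℝ) - 1))

/-- `B(q) = max(0, 2 log log q + 3 + 2ω(q)(log log q)²/log q − 2A(q))` (Theorem 1.1; `ω(q)` = number of
distinct prime factors). [cite: LamzouriLiSoundararajan2015, Theorem 1.1 p. 2392] -/
def B (q : ℕ) : ℝ :=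
  max 0 (2 * Real.log (Real.log q) + 3 +
    2 * (q.primeFactors.card : ℝ) * Real.log (Real.log q) ^ 2 / Real.log q - 2 * A q)

/-- The CORRECTED constants of Theorem 1.2: `α(2) = 0.8`, `α(3) = 0.7`, `α(h) = 0.66` for `h > 3`
(Corrigendum 2017; the 2015 values `0.42, 0.49, 0.51` are superseded).
[cite: LamzouriLiSoundararajan2017Corrigendum, Theorem 1.2 p. 2551] -/
def alpha (h : ℕ) : ℝ := if h = 2 then 0.8 else if h = 3 then 0.7 else 0.66

/-- `B(q) ≥ 0`. [cite: LamzouriLiSoundararajan2015, Theorem 1.1 p. 2392] -/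
theorem B_nonneg (q : ℕ) : 0 ≤ B q := le_max_left _ _

/-- An integer lying in a subgroup of `(ℤ/qℤ)*` is a unit mod `q`.
[cite: LamzouriLiSoundararajan2015, §1 p. 2391 ("the group of reduced residues")] -/
theorem LiesIn.isUnit {q : ℕ} {H : Subgroup (ZMod q)ˣ} {n : ℕ} (h : LiesIn H n) :
    IsUnit (n : ZMod q) := by
  obtain ⟨u, -, hu⟩ := h
  rw [← hu]
  exact Units.isUnit u

/-- A prime (indeed any `n`) sharing a factor with `q > 1` lies in NO subgroup of `(ℤ/qℤ)*` — in
particular "the least prime not in `H`" may divide `q` (p. 2392, Bach's `2(log q)²` vs `3(log q)²`).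
[cite: LamzouriLiSoundararajan2015, §1 p. 2392] -/
theorem not_liesIn_of_not_coprime {q : ℕ} (H : Subgroup (ZMod q)ˣ) {n : ℕ}
    (hn : ¬ n.Coprime q) : ¬ LiesIn H n := by
  intro h
  exact hn ((ZMod.isUnit_iff_coprime n q).mp h.isUnit)

/-- For a prime `p ∣ q`, `p` lies in no subgroup of `(ℤ/qℤ)*` (it is not coprime to `q`).
[cite: LamzouriLiSoundararajan2015, §1 p. 2392] -/
theorem not_liesIn_of_dvd {q : ℕ} (H : Subgroup (ZMod q)ˣ) {p : ℕ} (hp : p.Prime)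
    (hpq : p ∣ q) : ¬ LiesIn H p :=
  not_liesIn_of_not_coprime H (by
    rw [Nat.Prime.coprime_iff_not_dvd hp]
    exact fun h => h hpq)

/-- Lying in the coset `1·H` is lying in `H`. [cite: LamzouriLiSoundararajan2015, §1 p. 2391] -/
theorem liesInCoset_one_iff {q : ℕ} (H : Subgroup (ZMod q)ˣ) (n : ℕ) :
    LiesInCoset H 1 n ↔ LiesIn H n := by
  simp [LiesInCoset, LiesIn]

end LamzouriLiSoundararajan2015

open LamzouriLiSoundararajan2015
open Literature.NumberTheory.Congruences.LeastNonresidue (leastNonresidue)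

/-- **Lamzouri–Li–Soundararajan 2015, Theorem 1.1 (NAMED FACT, as printed).** Assume GRH; `q ≥ 3000`,
`H` a proper subgroup of `(ℤ/qℤ)*`. (1) Some prime `ℓ ∤ q` not lying in `H` has
`ℓ ≤ (log q + B(q))²`; (2) if no prime below `(log q)²` divides `q`, some prime `ℓ ≤ (log q)²` does
not lie in `H`. Unaffected by the 2017 Corrigendum.
[cite: LamzouriLiSoundararajan2015, Theorem 1.1 p. 2392] -/
def lamzouriLiSoundararajan2015_theorem11 : Prop :=
  GeneralizedRiemannHypothesis →
    ∀ (q : ℕ), 3000 ≤ q → ∀ H : Subgroup (ZMod q)ˣ, H ≠ ⊤ →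
      (∃ ℓ : ℕ, ℓ.Prime ∧ ¬ ℓ ∣ q ∧ ¬ LiesIn H ℓ ∧ (ℓ : ℝ) ≤ (Real.log q + B q) ^ 2) ∧
      ((∀ p : ℕ, p.Prime → p ∣ q → Real.log q ^ 2 ≤ (p : ℝ)) →
        ∃ ℓ : ℕ, ℓ.Prime ∧ ¬ LiesIn H ℓ ∧ (ℓ : ℝ) ≤ Real.log q ^ 2)

/-- **Lamzouri–Li–Soundararajan 2015, Corollary 1.1 (NAMED FACT, as printed).** "Assume GRH. If `q ≥ 5`
is prime, the least quadratic non-residue (mod `q`) lies below `(log q)²`." With the tree's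
`leastNonresidue` (Niven–Zuckerman Thm 3.9); "below" typed as `≤`.
[cite: LamzouriLiSoundararajan2015, Corollary 1.1 p. 2392] -/
def lamzouriLiSoundararajan2015_corollary11 : Prop :=
  GeneralizedRiemannHypothesis →
    ∀ (q : ℕ) [Fact q.Prime] (hq : 5 ≤ q),
      (leastNonresidue q (show q ≠ 2 by omega) : ℝ) ≤ Real.log q ^ 2

/-- **Lamzouri–Li–Soundararajan, Theorem 1.2 in the CORRECTED form of the 2017 Corrigendum (NAMED
FACT).** Assume GRH. For `q` large and `H` of index `h > 1`, the least prime `p` not in `H` satisfies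
`p < (α(h) + o(1))(log q)²` with `α(2) = 0.8`, `α(3) = 0.7`, `α(h) = 0.66` (`h > 3`). Rendered: for
every `ε > 0` and `h > 1` there is `q₀` such that for `q ≥ q₀` and every subgroup `H` of `(ℤ/qℤ)*` of
index `h`, some prime `p` not lying in `H` has `p < (α(h) + ε)(log q)²`.
[cite: LamzouriLiSoundararajan2017Corrigendum, Theorem 1.2 p. 2551]
[cite: LamzouriLiSoundararajan2015, Theorem 1.2 p. 2392 (superseded constants)] -/
def lamzouriLiSoundararajan2015_theorem12 : Prop :=
  GeneralizedRiemannHypothesis →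
    ∀ ε : ℝ, 0 < ε → ∀ h : ℕ, 1 < h → ∃ q₀ : ℕ, ∀ q : ℕ, q₀ ≤ q →
      ∀ H : Subgroup (ZMod q)ˣ, H.index = h →
        ∃ p : ℕ, p.Prime ∧ ¬ LiesIn H p ∧ (p : ℝ) < (alpha h + ε) * Real.log q ^ 2

/-- **Lamzouri–Li–Soundararajan, Theorem 1.3 in the CORRECTED form of the 2017 Corrigendum (NAMED
FACT).** Assume GRH. For `q` large and `H` of index `h ≥ 4`, the least prime `p` not in `H` satisfies
`p < (1/4 + o(1)) (1 − 1/h)² (log(2h)/(log(2h) − 4))² (log q)²`. Rendered with `o(1) ↦ ε` beyond a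
threshold `q₀(ε, h)`. [cite: LamzouriLiSoundararajan2017Corrigendum, Theorem 1.3 p. 2551]
[cite: LamzouriLiSoundararajan2015, Theorem 1.3 p. 2392 (superseded: log(2h) − 2)] -/
def lamzouriLiSoundararajan2015_theorem13 : Prop :=
  GeneralizedRiemannHypothesis →
    ∀ ε : ℝ, 0 < ε → ∀ h : ℕ, 4 ≤ h → ∃ q₀ : ℕ, ∀ q : ℕ, q₀ ≤ q →
      ∀ H : Subgroup (ZMod q)ˣ, H.index = h →
        ∃ p : ℕ, p.Prime ∧ ¬ LiesIn H p ∧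
          (p : ℝ) < (1 / 4 + ε) * (1 - 1 / (h : ℝ)) ^ 2 *
            (Real.log (2 * h) / (Real.log (2 * h) - 4)) ^ 2 * Real.log q ^ 2

/-- **Lamzouri–Li–Soundararajan 2015, Theorem 1.4 (NAMED FACT, as printed).** Assume GRH; `q ≥ 20000`,
`H` of index `h > 1`, `aH` a coset. The smallest prime `p` lying in `aH` satisfies: either `p ≤ 10⁹`,
or `p ≤ ((h − 1) log q + 3(h + 1) + (5/2)(log log q)²)²`. Unaffected by the Corrigendum.
[cite: LamzouriLiSoundararajan2015, Theorem 1.4 p. 2393] -/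
def lamzouriLiSoundararajan2015_theorem14 : Prop :=
  GeneralizedRiemannHypothesis →
    ∀ (q : ℕ), 20000 ≤ q → ∀ H : Subgroup (ZMod q)ˣ, 1 < H.index → ∀ a : (ZMod q)ˣ,
      ∃ p : ℕ, p.Prime ∧ LiesInCoset H a p ∧
        ((p : ℝ) ≤ 10 ^ 9 ∨
          (p : ℝ) ≤ ((H.index - 1 : ℝ) * Real.log q + 3 * ((H.index : ℝ) + 1) +
            5 / 2 * Real.log (Real.log q) ^ 2) ^ 2)

/-- **Lamzouri–Li–Soundararajan 2015, Corollary 1.2 (NAMED FACT, as printed).** "Assume GRH. Let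
`q > 3`, and let `a` (mod `q`) be a reduced residue class. The least prime in the arithmetic progression
`a` (mod `q`) satisfies `P(a, q) ≤ (φ(q) log q)²`." Same shape as the tree's `linnik_leastPrimeAP`
(`a : ℕ` coprime to `q`, `p ≡ a (mod q)`). Unaffected by the Corrigendum.
[cite: LamzouriLiSoundararajan2015, Corollary 1.2 p. 2393] -/
def lamzouriLiSoundararajan2015_corollary12 : Prop :=
  GeneralizedRiemannHypothesis →
    ∀ q : ℕ, 3 < q → ∀ a : ℕ, a.Coprime q →
      ∃ p : ℕ, p.Prime ∧ p ≡ a [MOD q] ∧ (p : ℝ) ≤ ((Nat.totient q : ℝ) * Real.log q) ^ 2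

namespace LamzouriLiSoundararajan2015

/-- From Corollary 1.2: under GRH, `P(a, q) ≤ (q log q)²` for `q > 3`, `(a, q) = 1` (as `φ(q) ≤ q`;
Bach–Sorenson's explicit (1.2) had `2(q log q)²`). [cite: LamzouriLiSoundararajan2015, (1.2) and Corollary 1.2 p. 2393] -/
theorem leastPrimeAP_le_sq_of_corollary12 (h : lamzouriLiSoundararajan2015_corollary12)
    (hGRH : GeneralizedRiemannHypothesis) {q : ℕ} (hq : 3 < q) {a : ℕ} (ha : a.Coprime q) :
    ∃ p : ℕ, p.Prime ∧ p ≡ a [MOD q] ∧ (p : ℝ) ≤ ((q : ℝ) * Real.log q) ^ 2 := by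
  obtain ⟨p, hp, hpa, hle⟩ := h hGRH q hq a ha
  refine ⟨p, hp, hpa, hle.trans ?_⟩
  have hlog : 0 ≤ Real.log q := Real.log_nonneg (by exact_mod_cast (by omega : 1 ≤ q))
  have hφ : (Nat.totient q : ℝ) ≤ q := by exact_mod_cast Nat.totient_le q
  have h0 : 0 ≤ (Nat.totient q : ℝ) * Real.log q := mul_nonneg (Nat.cast_nonneg _) hlog
  exact pow_le_pow_left₀ h0 (mul_le_mul_of_nonneg_right hφ hlog) 2

/-- From Theorem 1.4 with the trivial coset: under GRH, for `q ≥ 20000` and `H` of index `h > 1` some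
prime LYING IN `H` is `≤ max(10⁹, ((h−1) log q + 3(h+1) + (5/2)(log log q)²)²)`.
[cite: LamzouriLiSoundararajan2015, Theorem 1.4 p. 2393] -/
theorem exists_prime_liesIn_of_theorem14 (h : lamzouriLiSoundararajan2015_theorem14)
    (hGRH : GeneralizedRiemannHypothesis) {q : ℕ} (hq : 20000 ≤ q) (H : Subgroup (ZMod q)ˣ)
    (hH : 1 < H.index) :
    ∃ p : ℕ, p.Prime ∧ LiesIn H p ∧
      (p : ℝ) ≤ max (10 ^ 9) (((H.index - 1 : ℝ) * Real.log q + 3 * ((H.index : ℝ) + 1) +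
        5 / 2 * Real.log (Real.log q) ^ 2) ^ 2) := by
  obtain ⟨p, hp, hcos, hle⟩ := h hGRH q hq H hH 1
  refine ⟨p, hp, (liesInCoset_one_iff H p).mp hcos, ?_⟩
  rcases hle with h1 | h2
  · exact h1.trans (le_max_left _ _)
  · exact h2.trans (le_max_right _ _)

end LamzouriLiSoundararajan2015

end Literature.NumberTheory.LFunctions

end
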